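import Literature.MathematicalPhysics.QuantumFieldTheory.Balaban1983to89.B9Thm311IndefiniteInFrameClassCubeZd

/-!
# `Balaban1983to89.B9Thm311TwistPureGaugeZd` — [Balaban1985BackgroundPropagators] (3.26) p. 395 with (3.3)–(3.4) p. 391, (3.10) p. 392, (3.16) p. 393, p. 418
# («the linear gauge transformations A → A − Dλ») ON THE `ℤᵈ × 𝔸` CARRIER: AT THE CROSSING-BOND TWIST THE GENUINE FOUR-LETTER `Δ_a(U₀)` KILLS THE HERMITIAN
# PURE GAUGE `D_{U₀}λ` UP TO THE GAUGE-FIXING LETTER — the twist's bond variables `±1` are CENTRAL, so `D_{U₀}` is the flat derivative and every plaquette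
# variable is `±1`: `D*D(D_{U₀}λ) = 0`, `Δ′(U₀)(D_{U₀}λ) = 0`, `Q*aQ(U₀) ≡ 0`, and `D R(U₀) 𝟙 D*(D_{U₀}λ) = D R(U₀)(𝟙_{Ω₀}Δ^η_{U₀}λ)`

statement-level skeleton of published theorems with citation tags; proofs where landed; nothing here is a claim about the
Yang–Mills mass gap

`[Balaban1985BackgroundPropagators]` ("B9", CMP **99** (1985) 389–434; journal page = PDF page + 388): p. 390 «R(U)X = UXU⁻¹», (3.3)–(3.6) p. 391 (covariant
derivatives; `(D_U D_U λ)(p) = [holonomy, λ]`), (3.10) p. 392 (`Δ = D*D + Δ′`), (3.16) p. 393 (`Q*aQ`), (3.21)–(3.23) p. 394 (`R(U)`, `Δ^η_U = D*D` on scalars),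
(3.26)–(3.27) p. 395, (3.35) p. 396, Thm 3.11 p. 416, p. 418 («A → A − Dλ … Q_jDλ = D_jQ′_jλ (3.115)»).  `[Balaban1985RegularSpaces]` ("B8") (1.1) p. 76, (1.7) p. 77.
PDF held: `paper:balaban1985-cmp99-background-propagators`.

CITATION HEADER ∕ WHY THIS FILE (cell `pub-ymgap`, HUMAN RULING D-0062 ∕ D-0149; width seat `pub-ymgap-dag-n06-w3` (g5), node N06 = [B9]; CLAIM-2 file 1∕3;
count-neutral).  CLAIM-1 of this seat (`B9Thm311IndefiniteInFrameClassCubeZd`, with its two letter files) certified the SIGN half of dag-n06-b g20's LOCATED-SELF-7: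
inside the frame class (3.35) of a cube member the genuine `Δ_a(U₀)` is indefinite on `E_𝔤(□₀)`.  CLAIM-2 goes further — the class holds a SINGULAR background:
at the same crossing-bond twist `U₀` (`−1` on one bond `b` based outside `Ω₀` with its far end inside, `1` elsewhere) there is a Hermitian PURE GAUGE
`A = D_{U₀}λ ≠ 0` in `E_𝔤(Ω₀)` with `Δ_a(U₀)A = 0`, so Theorem 3.11's conclusion «`G = (Δ_a↾Ω₀)⁻¹` exists» and the junction's frame-keyed (3.27) binder FAIL at a
class point (the kernel certificate of LOCATED-SELF-6; dag-n06-b g18's `B9SupplySockB9P3ZdSkewGaugeMode` did this for the `𝔸`-valued class with SKEW gauges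
at the flat background — Hermitian gauges need the twist).  THIS file is the letter-by-letter algebra: (§1) the twist is CENTRAL (`±1` commute with
everything), so its covariant derivatives are the flat ones and all its plaquette variables are `±1` (hence the commutator weight `y(p) = η⁻² Im U(∂p)` of
(3.10) vanishes identically); (§2) on the pure gauge `D_{U₀}λ` of ANY `λ`: the plaquette derivative (3.4) vanishes (curl of a gradient at central holonomy), so
`D*D` and the Jordan term of `Δ′` vanish, the commutator letters vanish, `Q*aQ` is switched off by its (1.7) guard (file `…IndefiniteInFrameClassCubeZd`), and the
gauge-fixing letter reads `R(U₀)(𝟙_{Ω₀}Δ^η_{U₀}λ)` — zero as soon as that projection is.  Files 2∕3 (`B9Eq321ProjectorKernelZd`: such a `λ ≠ 0` exists by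
rank–nullity) and 3∕3 (`B9Thm311SingularInFrameClassCubeZd`: the frame-level statements) complete the claim.

WHAT IS PROVED (kernel, 0 sorry; theorems only — no `def`, `instance`, `notation`; the twist `U₀` and the field enter through the hypothesis `hU` of file
`B9Eq310TwistedBondDstarDZd` and the literal gauge `fun y κ => covDerivFwd η U₀ κ λ y`).
* §1 `twist_eq_one_or`, ★ `conjR_twist ∕ conjR_twist_inv ∕ R_twist' ∕ R_twist ∕ R_twist_inv` (centrality), ★ `covDerivFwd_twist ∕ covDeriv_twist` (flat derivatives),
  ★ `plaqU_twist_pm_one`, ★ `yP_twist_eq_zero` (with pv27's `imC_one` ∕ file 2's `imC_neg_one`), `commG_twist_all`.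
* §2 `gauge_apply`, ★ `plaqCovDeriv_gauge_twist` (= 0), ★ `Jcur_gauge_twist` (`D*D(D_{U₀}λ) = 0`), `curl_gauge_twist ∕ jordanF_gauge_twist ∕ deltaPrimeOp_gauge_twist`,
  ★ `DpZd_gauge_twist` (`Δ′(U₀)(D_{U₀}λ) = 0`), `covDivB_gauge` (`D*(D_{U₀}λ) = Δ^η_{U₀}λ`, rfl), ★ `DRDs_gauge_eq_zero` (given
  `R(U₀)(𝟙_{Ω₀}Δ^η_{U₀}λ) = 0`), ★★ `deltaAOf_opsAllZd_gauge_twist_eq_zero` (all four letters: `Δ_a(U₀)(D_{U₀}λ) = 0` on EVERY bond, at a member with finite `Ω₀`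
  containing the far end of the twisted bond, `L ≥ 1`, a direction `κ ≠ ν`), `deltaAOf_opsAllZd_zero_twist` (`Δ_a(U₀)0 = 0`).

HONEST SCOPE.  Finite non-commutative algebra at one explicit background (centrality bookkeeping + the (3.10) letters of pv27's `B9Eq310Hermitian` transported by dag-n06-w2's dictionary); no estimate of [B9]; count-neutral helper of K1⁹ (`--supports stmt-QuantumFields-27364`); N05 ∕ N06 NOT discharged; K1⁹ NOT closed;
one finite `𝕋⁴` programme at fixed `ε`, Bałaban as printed; R4 closes only the conditional finite-`𝕋⁴` rung `BalabanLadder.UV` — nothing continuum ∕ `ℝ⁴` ∕ OS ∕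
mass gap ∕ Clay.  Unit `pub-ymgap-dag-n06-w3` (g5), 2026-08-28.
-/

noncomputable section

open scoped BigOperators
open NormedSpace Complex

namespace Literature.MathematicalPhysics.QuantumFieldTheory.Balaban1983to89.B9Thm311TwistPureGaugeZd

open B7Prop1Explicit (e)
open B7Prop2Explicit (unitaryUnits)
open B7Eq78Linearization (conjR QprimeIter_zero)
open B8Ineq132 (PlaqTouches BondTouches plaqF covDeriv covDerivFwd)
open B8Eq138LandauZd (covDivB covLap)
open B8Eq133Hypotheses (shiftT byDir byDir_apply)
open B8Eq131Cubes (sqLo sqHi inLo inHi)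
open B8Eq131CubesAdmissible (cubeFam cubeFam_false_zero)
open B8CubeMemberZd (cubeLamS cubeLam)
open B8Ineq159FlatCubeMemberKernel (mem_cube_zero_iff)
open B8LeafModelZd (ZdIdx)
open B8Eq155JBound (Jcur)
open B8Eq146AExpansion (plaqCovDeriv)
open B8Eq143PlaqExpansion (pdiv)
open B8ScaledSupNorm (weight Bdd weight_nonneg)
open B9SupplySockB9P3ZdFrame (bgZd memZd ιCfgZd)
open B9SupplySockB9P3ZdLetters (OpsZd deltaAOf)
open B9SupplySockB9P3ZdLettersOmega (OnDom restrictDom restrictDom_of restrictDom_of_not)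
open B9SupplySockB9P3ZdAllLettersZd (opsAllZd)
open B9SupplySockB9P3ZdAtHerm (InvAtH)
open B9Eq321LandauProjectionZd (suppSub gaugeNull rangeGen rangeSub projE projR indicator_mem_suppSub projE_apply_mem_range)
open B9Eq327GreenZd (domSub)
open B9Eq327GreenZdHerm (domSubH RegularAtH RegularInClassAtH withGopZdH deltaAOf_withGopZdH)
open B9Eq37Insertion (imC imC_one)
open B9Eq39Adjoint (R covD covDstar curl plaqU divP R_zero)
open B9Eq310Hermitian (yP jordanF commG₁ commG₂ commG₃ commG₄ divL deltaPrimeOp)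
open B9Eq369CurvSmallZd (DpZd shiftT_symm_apply)
open B9Thm311PerMemberCubeZdTouching (sqLo_le_sqHi_zero)
open B9Eq310TwistedBondDstarDZd B9Eq310TwistedBondDeltaPrimeZd B9Thm311IndefiniteInFrameClassCubeZd

export B7Prop1Explicit (Site)

variable {d : ℕ}

/-! ## §1  The twisted background is CENTRAL: its covariant derivatives are the flat ones, its plaquette variables are `±1` -/

section Central

variable {𝔸 : Type*} [CStarAlgebra 𝔸]
variable (z : Site d) (ν : Fin d) (η : ℝ)
variable {U₀ : Site d → Fin d → 𝔸ˣ} (hU : ∀ y κ, U₀ y κ = if y = z ∧ κ = ν then -1 else 1)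

/-- `R(X)0 = 0`. [cite: Balaban1985BackgroundPropagators, (3.3) p.390 (bookkeeping)] -/
private theorem conjR_zero' (X : 𝔸ˣ) : conjR X (0 : 𝔸) = 0 := by
  simp [conjR]

include hU in
/-- every bond variable of the twist is `1` or `−1`. [cite: Balaban1985BackgroundPropagators, (3.35) p.396 (bookkeeping)] -/
theorem twist_eq_one_or (y : Site d) (κ : Fin d) : U₀ y κ = 1 ∨ U₀ y κ = -1 := by
  rw [hU]
  split_ifs
  · exact Or.inr rfl
  · exact Or.inl rfl

include hU in
/-- ★ the twist is CENTRAL: `R(U₀(b))X = X` for every bond `b` and every `X`. [cite: Balaban1985BackgroundPropagators, p.390 («R(U)X = UXU⁻¹»)] -/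
theorem conjR_twist (y : Site d) (κ : Fin d) (X : 𝔸) : conjR (U₀ y κ) X = X := by
  rcases twist_eq_one_or z ν hU y κ with h | h
  · rw [h, B8Ineq132.one_conjR]
  · rw [h, conjR, inv_neg_one, Units.val_neg, Units.val_one]
    simp

include hU in
/-- … and so is its inverse. [cite: Balaban1985BackgroundPropagators, p.390 («R(U)X = UXU⁻¹»)] -/
theorem conjR_twist_inv (y : Site d) (κ : Fin d) (X : 𝔸) : conjR (U₀ y κ)⁻¹ X = X := by
  rcases twist_eq_one_or z ν hU y κ with h | h
  · rw [h, inv_one, B8Ineq132.one_conjR]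
  · rw [h, inv_neg_one, conjR, inv_neg_one, Units.val_neg, Units.val_one]
    simp

include hU in
/-- the model letter `R` at the twist is the identity: `R(U₀(y,κ))X = X`. [cite: Balaban1985BackgroundPropagators, p.390 («R(U)X = UXU⁻¹»)] -/
theorem R_twist' (y : Site d) (κ : Fin d) (X : 𝔸) : R (U₀ y κ) X = X :=
  conjR_twist z ν hU y κ X

include hU in
/-- the transported model's `R` at the twist is the identity as well. [cite: Balaban1985BackgroundPropagators, p.390 («R(U)X = UXU⁻¹»)] -/
theorem R_twist (κ : Fin d) (y : Site d) (X : 𝔸) : R (byDir U₀ κ y) X = X :=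
  conjR_twist z ν hU y κ X

include hU in
/-- … and its inverse. [cite: Balaban1985BackgroundPropagators, p.390 («R(U)X = UXU⁻¹»)] -/
theorem R_twist_inv (κ : Fin d) (y : Site d) (X : 𝔸) : R (byDir U₀ κ y)⁻¹ X = X :=
  conjR_twist_inv z ν hU y κ X

include hU in
/-- ★ **AT THE TWIST THE FORWARD COVARIANT DERIVATIVE (1.1) IS THE FLAT ONE**: `(D^η_{U₀,κ}F)(y) = η⁻¹(F(y + e_κ) − F(y))`.
[cite: Balaban1985RegularSpaces, (1.1) p.76; Balaban1985BackgroundPropagators, (3.3) p.391] -/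
theorem covDerivFwd_twist (κ : Fin d) (F : Site d → 𝔸) (y : Site d) : covDerivFwd η U₀ κ F y = η⁻¹ • (F (y + e κ) - F y) := by
  rw [covDerivFwd, conjR_twist z ν hU]

include hU in
/-- … and so is the backward one: `(D^{η*}_{U₀,κ}F)(y) = η⁻¹(F(y − e_κ) − F(y))`. [cite: Balaban1985RegularSpaces, (1.1) p.76] -/
theorem covDeriv_twist (κ : Fin d) (F : Site d → 𝔸) (y : Site d) : covDeriv η U₀ κ F y = η⁻¹ • (F (y - e κ) - F y) := by
  rw [covDeriv, conjR_twist_inv z ν hU]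

include hU in
/-- ★ every plaquette variable of the twist (in the transported model) is `1` or `−1` — a product of four bond variables `±1`.
[cite: Balaban1985BackgroundPropagators, (3.1) p.390] -/
theorem plaqU_twist_pm_one (μ κ : Fin d) (x : Site d) :
    plaqU (shiftT d) (byDir U₀) μ κ x = 1 ∨ plaqU (shiftT d) (byDir U₀) μ κ x = -1 := by
  have hmul : ∀ a b : 𝔸ˣ, (a = 1 ∨ a = -1) → (b = 1 ∨ b = -1) → (a * b = 1 ∨ a * b = -1) := by
    rintro a b (rfl | rfl) (rfl | rfl)
    · exact Or.inl (one_mul 1)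
    · exact Or.inr (one_mul _)
    · exact Or.inr (mul_one _)
    · exact Or.inl (by rw [neg_mul_neg, one_mul])
  have hinv : ∀ a : 𝔸ˣ, (a = 1 ∨ a = -1) → (a⁻¹ = 1 ∨ a⁻¹ = -1) := by
    rintro a (rfl | rfl)
    · exact Or.inl inv_one
    · exact Or.inr inv_neg_one
  simp only [plaqU, byDir_apply, B8Eq133Hypotheses.shiftT_apply]
  exact hmul _ _ (hmul _ _ (hmul _ _ (twist_eq_one_or z ν hU _ _) (twist_eq_one_or z ν hU _ _)) (hinv _ (twist_eq_one_or z ν hU _ _)))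
    (hinv _ (twist_eq_one_or z ν hU _ _))

include hU in
/-- ★ **AT THE TWIST THE COMMUTATOR WEIGHT OF (3.10) VANISHES EVERYWHERE**: `y(p) = η⁻² Im U₀(∂p) = 0` for every plaquette.
[cite: Balaban1985BackgroundPropagators, (3.10) p.392] -/
theorem yP_twist_eq_zero (μ κ : Fin d) (x : Site d) : yP (shiftT d) (byDir U₀) η μ κ x = 0 := by
  rcases plaqU_twist_pm_one z ν hU μ κ x with h | h
  · rw [yP, h, B9Eq37Insertion.imC_one, smul_zero]
  · rw [yP, h, imC_neg_one, smul_zero]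

include hU in
/-- hence all four commutator letter functions of (3.10) vanish at the twist, for every field. [cite: Balaban1985BackgroundPropagators, (3.10) p.392] -/
theorem commG_twist_all (B : Fin d → Site d → 𝔸) (μ κ : Fin d) (x : Site d) :
    commG₁ (shiftT d) (byDir U₀) η B μ κ x = 0 ∧ commG₂ (shiftT d) (byDir U₀) η B μ κ x = 0 ∧
      commG₃ (shiftT d) (byDir U₀) η B μ κ x = 0 ∧ commG₄ (shiftT d) (byDir U₀) η B μ κ x = 0 := by
  simp only [commG₁, commG₂, commG₃, commG₄, yP_twist_eq_zero z ν η hU, zero_mul, mul_zero, sub_zero, smul_zero, and_self]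

end Central

/-! ## §2  The Hermitian pure gauge `A = D_{U₀}λ` at the twist: three letters of `Δ_a(U₀)` kill it outright, the fourth reads `R(U₀)(𝟙Δλ)` -/

section Gauge

variable {𝔸 : Type*} [CStarAlgebra 𝔸]
variable (z : Site d) (ν : Fin d) (η : ℝ)
variable {U₀ : Site d → Fin d → 𝔸ˣ} (hU : ∀ y κ, U₀ y κ = if y = z ∧ κ = ν then -1 else 1)
variable (lam : Site d → 𝔸)

include hU in
/-- the pure gauge `A = D^η_{U₀}λ` at the twist, bond by bond: `A(y, κ) = η⁻¹(λ(y + e_κ) − λ(y))`. [cite: Balaban1985BackgroundPropagators, (3.3) p.391, p.418 («A → A − Dλ»)] -/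
theorem gauge_apply (y : Site d) (κ : Fin d) :
    (fun y κ => covDerivFwd η U₀ κ lam y) y κ = η⁻¹ • (lam (y + e κ) - lam y) :=
  covDerivFwd_twist z ν η hU κ lam y

include hU in
/-- ★ **THE PLAQUETTE DERIVATIVE (3.4) OF THE PURE GAUGE VANISHES AT THE TWIST** (curl of a gradient at central holonomy).
[cite: Balaban1985BackgroundPropagators, (3.4) p.391, (3.6) p.391] -/
theorem plaqCovDeriv_gauge_twist (μ κ : Fin d) (x : Site d) :
    plaqCovDeriv η U₀ (fun y κ => covDerivFwd η U₀ κ lam y) μ κ x = 0 := by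
  rw [B8Eq146AExpansion.plaqCovDeriv_eq_covDerivFwd, covDerivFwd_twist z ν η hU, covDerivFwd_twist z ν η hU]
  simp only [covDerivFwd_twist z ν η hU]
  rw [add_right_comm x (e κ) (e μ)]
  module

include hU in
/-- ★ **`D*D` KILLS THE PURE GAUGE AT THE TWIST**: `D^{η*}_{U₀}D^η_{U₀}(D_{U₀}λ) = 0`. [cite: Balaban1985RegularSpaces, (1.55) p.86; Balaban1985BackgroundPropagators, (3.9)–(3.10) p.392] -/
theorem Jcur_gauge_twist (μ : Fin d) (x : Site d) : Jcur η U₀ (fun y κ => covDerivFwd η U₀ κ lam y) μ x = 0 := by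
  have hF : plaqCovDeriv η U₀ (fun y κ => covDerivFwd η U₀ κ lam y) = fun _ _ _ => 0 := by
    funext μ' κ' x'; exact plaqCovDeriv_gauge_twist z ν η hU lam μ' κ' x'
  rw [B8Eq155JBound.Jcur_def, hF]
  simp [pdiv, covDeriv, conjR_zero']

include hU in
/-- the unit curl (3.4) of the pure gauge in the transported model vanishes at the twist. [cite: Balaban1985BackgroundPropagators, (3.4) p.391] -/
theorem curl_gauge_twist (μ κ : Fin d) (x : Site d) :
    curl (shiftT d) (byDir U₀) (byDir fun y κ => covDerivFwd η U₀ κ lam y) μ κ x = 0 := by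
  simp only [curl, covD, B8Eq133Hypotheses.shiftT_apply, byDir_apply, R_twist' z ν hU, covDerivFwd_twist z ν η hU]
  rw [add_right_comm x (e κ) (e μ)]
  module

include hU in
/-- hence the Jordan-symmetrised first term of (3.10) vanishes on the pure gauge at the twist. [cite: Balaban1985BackgroundPropagators, (3.10) p.392] -/
theorem jordanF_gauge_twist (μ κ : Fin d) (x : Site d) :
    jordanF (shiftT d) (byDir U₀) η (byDir fun y κ => covDerivFwd η U₀ κ lam y) μ κ x = 0 := by
  rw [jordanF, curl_gauge_twist z ν η hU lam, zero_mul, mul_zero, add_zero, smul_zero]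

include hU in
/-- ★ **`Δ′(U₀)` KILLS THE PURE GAUGE AT THE TWIST** (transported (3.10) operator): `D¹A = 0` kills the first term, `y(p) = 0` the commutator term.
[cite: Balaban1985BackgroundPropagators, (3.10) p.392] -/
theorem deltaPrimeOp_gauge_twist (μ : Fin d) (x : Site d) :
    deltaPrimeOp (shiftT d) (byDir U₀) η (byDir fun y κ => covDerivFwd η U₀ κ lam y) μ x = 0 := by
  have hJ : jordanF (shiftT d) (byDir U₀) η (byDir fun y κ => covDerivFwd η U₀ κ lam y) = fun _ _ _ => 0 := by
    funext μ' κ' x'; exact jordanF_gauge_twist z ν η hU lam μ' κ' x'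
  have hG : ∀ B : Fin d → Site d → 𝔸, commG₁ (shiftT d) (byDir U₀) η B = (fun _ _ _ => 0) ∧ commG₂ (shiftT d) (byDir U₀) η B = (fun _ _ _ => 0) ∧
      commG₃ (shiftT d) (byDir U₀) η B = (fun _ _ _ => 0) ∧ commG₄ (shiftT d) (byDir U₀) η B = (fun _ _ _ => 0) := by
    intro B
    refine ⟨?_, ?_, ?_, ?_⟩ <;> funext μ' κ' x'
    · exact (commG_twist_all z ν η hU B μ' κ' x').1
    · exact (commG_twist_all z ν η hU B μ' κ' x').2.1
    · exact (commG_twist_all z ν η hU B μ' κ' x').2.2.1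
    · exact (commG_twist_all z ν η hU B μ' κ' x').2.2.2
  obtain ⟨g1, g2, g3, g4⟩ := hG (byDir fun y κ => covDerivFwd η U₀ κ lam y)
  rw [deltaPrimeOp, hJ, g1, g2, g3, g4]
  simp [divP, divL, covDstar]

include hU in
/-- ★ **THE GENUINE `Δ′(U₀)` (`DpZd`) KILLS THE PURE GAUGE AT THE TWIST.** [cite: Balaban1985BackgroundPropagators, (3.10) p.392, (3.69) p.404] -/
theorem DpZd_gauge_twist : DpZd η U₀ (fun y κ => covDerivFwd η U₀ κ lam y) = 0 := by
  funext x μ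
  rw [B9Eq369CurvSmallZd.DpZd_apply, Pi.zero_apply, Pi.zero_apply]
  exact deltaPrimeOp_gauge_twist z ν η hU lam μ x

omit hU in
/-- the divergence of the pure gauge is the covariant Laplacian (3.23) of its potential (definitional). [cite: Balaban1985BackgroundPropagators, (3.23) p.394] -/
theorem covDivB_gauge : covDivB η U₀ (fun y κ => covDerivFwd η U₀ κ lam y) = covLap η U₀ lam := rfl

variable {L : ℕ} (τ : 𝔸 →ₗ[ℂ] ℂ) (ΛbP : ℕ → ℕ → Set (Site d × Fin d)) (ops₀ : ℝ → ZdIdx d L → ℕ → OpsZd d 𝔸) (M : ℝ) (i : ZdIdx d L) (m : ℕ)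

omit hU in
/-- ★ **THE GAUGE-FIXING LETTER READS `R(U₀)(𝟙_{Ω₀}Δ^η_{U₀}λ)`**: if that projection vanishes, `D R(U₀) 𝟙 D* (D_{U₀}λ) = 0` (member with finite `Ω₀`, the
constructed projection of (3.21)–(3.22)). [cite: Balaban1985BackgroundPropagators, (3.26) p.395, (3.21)–(3.23) p.394] -/
theorem DRDs_gauge_eq_zero [FiniteDimensional ℝ 𝔸] (hΩ : (i.Ω 0).Finite)
    (hproj : projR τ hΩ.toFinset L m i.η (i.Λs m) U₀ (covLap i.η U₀ lam) = 0) (y : Site d) (κ : Fin d) :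
    (opsAllZd τ L ΛbP ops₀ M i m).DRDs U₀ (fun y κ => covDerivFwd i.η U₀ κ lam y) y κ = 0 := by
  rw [B9SupplySockB9P3ZdAllLettersZd.opsAllZd_DRDs, B9Eq321LandauProjectionZd.opsLandau_DRDs_of_finite τ _ M i m hΩ, covDivB_gauge, hproj]
  simp [covDerivFwd, conjR]

include hU in
/-- ★★ **THE GENUINE FOUR-LETTER `Δ_a(U₀)` OF THE JUNCTION KILLS THE PURE GAUGE AT THE TWIST** — as a function on ALL bonds: `D*D` and `Δ′` by §1–§2, `Q*aQ`
because its (1.7) guard is off at the twist (the `−1` plaquette touches `Ω₀` through the far end `z + e_ν` of the twisted bond; `L ≥ 1`, a direction `κ ≠ ν`),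
and `D R 𝟙 D*` whenever `R(U₀)(𝟙_{Ω₀}Δ_{U₀}λ) = 0`. [cite: Balaban1985BackgroundPropagators, (3.26) p.395, Thm 3.11 p.416, (3.16) p.393; Balaban1985RegularSpaces, (1.7) p.77] -/
theorem deltaAOf_opsAllZd_gauge_twist_eq_zero [Nontrivial 𝔸] [FiniteDimensional ℝ 𝔸] (hL : 1 ≤ L) (hΩ : (i.Ω 0).Finite) (hx₀ : z + e ν ∈ i.Ω 0)
    {κ : Fin d} (hκ : κ ≠ ν) (hproj : projR τ hΩ.toFinset L m i.η (i.Λs m) U₀ (covLap i.η U₀ lam) = 0) :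
    deltaAOf i.η (opsAllZd τ L ΛbP ops₀ M i m) U₀ (fun y κ => covDerivFwd i.η U₀ κ lam y) = 0 := by
  funext y μ
  have hsplit : deltaAOf i.η (opsAllZd τ L ΛbP ops₀ M i m) U₀ (fun y κ => covDerivFwd i.η U₀ κ lam y) y μ =
      Jcur i.η U₀ (fun y κ => covDerivFwd i.η U₀ κ lam y) μ y + DpZd i.η U₀ (fun y κ => covDerivFwd i.η U₀ κ lam y) y μ +
        (opsAllZd τ L ΛbP ops₀ M i m).DRDs U₀ (fun y κ => covDerivFwd i.η U₀ κ lam y) y μ +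
        B9Eq316AveragingTransposeZdPrinted.QQZdP τ L ΛbP i m U₀ (fun y κ => covDerivFwd i.η U₀ κ lam y) y μ := rfl
  rw [hsplit, Jcur_gauge_twist z ν i.η hU lam, DpZd_gauge_twist z ν i.η hU lam, DRDs_gauge_eq_zero lam τ ΛbP ops₀ M i m hΩ hproj,
    QQZdP_twist_eq_zero z ν hU τ hL ΛbP i m hx₀ hκ _ y μ]
  simp

include hU in
/-- at the twist the genuine `Δ_a(U₀)` of the zero field is zero (each letter: `D*D 0 = 0`, `Δ′(U₀)`, `D R 𝟙 D*` homogeneous, `Q*aQ(U₀) ≡ 0`).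
[cite: Balaban1985BackgroundPropagators, (3.26) p.395 (linearity)] -/
theorem deltaAOf_opsAllZd_zero_twist [Nontrivial 𝔸] [FiniteDimensional ℝ 𝔸] (hL : 1 ≤ L) (hΩ : (i.Ω 0).Finite) (hx₀ : z + e ν ∈ i.Ω 0)
    {κ : Fin d} (hκ : κ ≠ ν) : deltaAOf i.η (opsAllZd τ L ΛbP ops₀ M i m) U₀ (0 : Site d → Fin d → 𝔸) = 0 := by
  funext y μ
  have hsplit : deltaAOf i.η (opsAllZd τ L ΛbP ops₀ M i m) U₀ (0 : Site d → Fin d → 𝔸) y μ =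
      Jcur i.η U₀ (0 : Site d → Fin d → 𝔸) μ y + DpZd i.η U₀ (0 : Site d → Fin d → 𝔸) y μ +
        (opsAllZd τ L ΛbP ops₀ M i m).DRDs U₀ (0 : Site d → Fin d → 𝔸) y μ +
        B9Eq316AveragingTransposeZdPrinted.QQZdP τ L ΛbP i m U₀ (0 : Site d → Fin d → 𝔸) y μ := rfl
  have hDp : DpZd i.η U₀ (0 : Site d → Fin d → 𝔸) = 0 := by
    have h := B9Eq369CurvSmallZd.DpZd_smul i.η U₀ (0 : ℂ) (0 : Site d → Fin d → 𝔸)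
    rwa [zero_smul, zero_smul] at h
  have hDRD : (opsAllZd τ L ΛbP ops₀ M i m).DRDs U₀ (0 : Site d → Fin d → 𝔸) = 0 := by
    have h := B9SupplySockB9P3ZdGenuineGop.opsLandau_DRDs_smul τ
      (B9SupplySockB9P3ZdGammaInAkDpZd.withDpZd (B9Eq316AveragingTransposeZdPrinted.withQQP τ L ΛbP ops₀)) M i m hΩ U₀ (0 : ℝ) (0 : Site d → Fin d → 𝔸)
    rw [zero_smul, zero_smul] at h
    rw [B9SupplySockB9P3ZdAllLettersZd.opsAllZd_DRDs]
    exact h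
  rw [hsplit, B9SupplySockB9P3ZdLettersOmega.Jcur_zero, hDp, hDRD, QQZdP_twist_eq_zero z ν hU τ hL ΛbP i m hx₀ hκ _ y μ]
  simp

end Gauge

end Literature.MathematicalPhysics.QuantumFieldTheory.Balaban1983to89.B9Thm311TwistPureGaugeZd

end
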